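import Literature.NumberTheory.EllipticCurves.IntSeriesIdentityPrinciple
import HarnessLib

/-!
# STUB-IDEAS k2·g7 — `stub_heegnerIndexLowerAtTwo` (crux `SplitBadTwoLowerHalfOfFacts`, item
# stmt-BirchSwinnertonDyer-27851): KINGS–SPRANG 2025 as the Katz side of record at `p = 2`, and the
# SQUARING-DYNAMICS structure lemma that makes the factorisation constant `(W-b)′` a one-point read-off.

TECHNIQUE (director): literature transfer (recent-theorem / open-question harvest; typed dictionary).

THE TRANSFER.  G. Kings – J. Sprang, *Eisenstein–Kronecker classes, integrality of critical values of
Hecke L-functions and p-adic interpolation*, Ann. of Math. 202 (2025) 1–109 (= arXiv:1912.03657, held),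
Theorem 5.24: for a CM field `L`, a prime `p ∤ d_L`, a `p`-ORDINARY CM type `Σ` and `𝔣` prime to `p` there
is an `𝒪_{ℂ_p}`-valued measure `μ_𝔣` on `Gal(L(p^∞𝔣)/L)` with
`(Ω_p^α Ω_p^{∨β})⁻¹ ∫ χ dμ_𝔣 = (α−1)!(2πi)^{|β|}(Ω^αΩ^{∨β})⁻¹ · Local(χ,Σ) · [𝒪_L^× : Γ] · ∏(1 − χ(𝔭⁻¹)/N𝔭)
· ∏(1 − χ(𝔭̄)) · L_𝔣(χ,0)` for EVERY critical `χ` of conductor dividing `p^∞𝔣` (arXiv p. 41), the local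
factor `Local(χ,Σ) = N(c)^{α₀}(P̃F)(c⁻¹)/(N̄(c)^{β₀}χ(𝔟))` of Def. 5.23 (p. 40) being explicit; the only
hypotheses are ORD-`p` and `p ∤ d_L` (p. 33) — NO parity clause in the 49 held pages (`rg 'p odd|p>2|p
\geq 3|p\neq 2'` = ∅).  Read at `(L, p, Σ, 𝔣, Γ) = (K₀ = ℚ(√−7), 2, {v}, 𝔮 = (√−7), 𝒪_𝔮^× = {1})`:
`2 ∤ 7`, `2 = v v̄` ordinary, and Katz's classical exclusion `p ∤ #𝒪_K^×` becomes the explicit digit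
`[𝒪^×:Γ] = 2`.  ONE measure `μ_𝔮` carries BOTH Katz factors `Ka`, `Kb` of the HARDEST-NOW node
(W-b)′ of STUB-PLAN v2.1 (row 18 K1), at every `2`-depth and at both `𝔭`/`𝔭̄`-ramifications, with the
in-range law E3 (`InRangeValuation`) and the carrier D2 (`IsKatzBranchRamified`, R46) as COROLLARIES.

THE STRUCTURE LEMMA (§1, PROVED).  Along the in-range points `x_m = u^{2^m} − 1 → 0` of the `χ'`-disc the
printed constants give `F(x_m) = c·U^{2^m}·ξ_m·G(x_m)` (`F` = LZZ's `𝓛(A_{f₀})` on the disc, `G = Ka·Kb`,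
`ξ_m` of norm one).  Because `F, G` are bounded power series, `‖F(x_m)‖ = ‖x_m‖^{f₀}·(→ ℓ_F ≠ 0)` with
`‖x_{m+1}‖ = ‖x_m‖/2`, so `‖c‖‖U‖^{2^m} = θ^m·L_m`, `L_m → L₀ > 0`, `θ = 2^{g₀−f₀}`; squaring dynamics then
FORCE `‖U‖ = 1` AND `θ = 1` (`unit_and_order_of_squaring`): the factorisation constant has CONSTANT
absolute value on the disc and `F`, `G` vanish to the SAME order at the out-of-range centre.  Hence
(§3) `w := ord₂ W₀` (`Ka·Kb = W₀·𝓛`, k2-g6's E2) is read at ANY ONE in-range point from the two printed interpolation formulas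
(`factorisationAtTwo_of_transport`, `w_pin` — L-value-free), and (W-b)′ = PRINT (LZZ Prop 4.12) ⊗ PRINT
(KS Thm 5.24, twice) ⊗ Artin ⊗ boundedness of `𝓛(A_{f₀})` on the disc (P-audit-LZZ) — no period
dictionary `P_ι ↔ Ω_p` along `k`, no «u a 1-unit» hypothesis: both are OUTPUTS.

§1 squaring dynamics (PROVED, real analysis) · §2 the B16 digit algebra of KS Def 5.23 (PROVED, `ring`)
· §3 the slots of k2-g6 (E2/E3, same bodies) filled from transport + printed digits (PROVED, `omega`).
No `sorry`; no instance; no notation.  BSD is NOT proved by any of this; S2′/T3 is not proved here: the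
file proves the LOGIC; the analytic inputs are NAMED in the card `Ideas/stub_heegnerIndexLowerAtTwo-k2.md`
(gate slug `stub-heegnerindexloweratwo-k2-g7`).
-/

noncomputable section

open Filter Topology

namespace Summit.BirchSwinnertonDyer.BirchSwinnertonDyer.Cruxes.SplitBadTwoLowerHalfOfFacts.HeegnerIndexTwo.K2G7

/-! ### §1. Squaring dynamics: `c·u^{2^m} = θ^m·L_m`, `L_m → L₀ > 0` forces `u = 1` and `θ = 1` -/

theorem tendsto_two_pow_atTop : Tendsto (fun n : ℕ => 2 ^ n) atTop atTop :=
  tendsto_pow_atTop_atTop_of_one_lt one_lt_two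

/-- If `0 ≤ u` and `u^{2^m}` converges to a POSITIVE real, then `u = 1`. -/
theorem eq_one_of_tendsto_pow_two_pow {u ℓ : ℝ} (hu : 0 ≤ u) (hℓ : 0 < ℓ)
    (h : Tendsto (fun n : ℕ => u ^ (2 ^ n)) atTop (𝓝 ℓ)) : u = 1 := by
  rcases lt_trichotomy u 1 with hlt | heq | hgt
  · have h0 : Tendsto (fun n : ℕ => u ^ (2 ^ n)) atTop (𝓝 0) :=
      (tendsto_pow_atTop_nhds_zero_of_lt_one hu hlt).comp tendsto_two_pow_atTop
    exact absurd (tendsto_nhds_unique h h0) hℓ.ne'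
  · exact heq
  · have hinf : Tendsto (fun n : ℕ => u ^ (2 ^ n)) atTop atTop :=
      (tendsto_pow_atTop_atTop_of_one_lt hgt).comp tendsto_two_pow_atTop
    exact absurd h (not_tendsto_nhds_of_tendsto_atTop hinf ℓ)

/-- The squaring step `u^{2^{m+1}} = (u^{2^m})²`. -/
theorem pow_two_pow_succ (u : ℝ) (n : ℕ) : u ^ (2 ^ (n + 1)) = (u ^ (2 ^ n)) ^ 2 := by
  rw [← pow_mul, pow_succ]

/-- **The structure lemma (sequence form).**  If `c·u^{2^m} = θ^m·L_m` for all `m`, with `c, θ > 0`,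
`u ≥ 0` and `L_m → L₀ > 0`, then `u = 1` AND `θ = 1`.  Reading: `c·u^{2^m}·(norm-one)` = the printed
factorisation constant at the `m`-th in-range point, `θ^m L_m` = the ratio `‖F(x_m)‖/‖G(x_m)‖` of two
bounded power series along `‖x_m‖ ≍ 2^{−m}` (`θ = 2^{ord G − ord F}`): the constant is a UNIT monomial
and the two sides vanish to the same order at the centre. -/
theorem unit_and_order_of_squaring {u c θ L₀ : ℝ} {L : ℕ → ℝ} (hu : 0 ≤ u) (_hc : 0 < c)
    (hθ : 0 < θ) (hL₀ : 0 < L₀) (hL : Tendsto L atTop (𝓝 L₀))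
    (h : ∀ n, c * u ^ (2 ^ n) = θ ^ n * L n) : u = 1 ∧ θ = 1 := by
  have hLpos : ∀ᶠ n in atTop, 0 < L n := hL.eventually (lt_mem_nhds hL₀)
  have key : ∀ n, u ^ (2 ^ n) * (θ ^ n * L n) = θ ^ (n + 1) * L (n + 1) := by
    intro n
    have h1 := h n
    have h2 := h (n + 1)
    rw [pow_two_pow_succ] at h2
    have hcu : c * (u ^ 2 ^ n) ^ 2 = u ^ 2 ^ n * (c * u ^ 2 ^ n) := by ring
    rw [← h2, hcu, h1]
  have hev : ∀ᶠ n in atTop, θ * (L (n + 1) / L n) = u ^ (2 ^ n) := by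
    filter_upwards [hLpos] with n hn
    have hθn : θ ^ n ≠ 0 := pow_ne_zero _ hθ.ne'
    have hne : θ ^ n * L n ≠ 0 := mul_ne_zero hθn hn.ne'
    have h3 : u ^ (2 ^ n) = (θ ^ (n + 1) * L (n + 1)) / (θ ^ n * L n) := by
      rw [eq_div_iff hne]; exact key n
    rw [h3, pow_succ]
    field_simp
  have hlim : Tendsto (fun n => θ * (L (n + 1) / L n)) atTop (𝓝 θ) := by
    have h1 : Tendsto (fun n => L (n + 1)) atTop (𝓝 L₀) := hL.comp (tendsto_add_atTop_nat 1)
    have h2 : Tendsto (fun n => L (n + 1) / L n) atTop (𝓝 (L₀ / L₀)) := h1.div hL hL₀.ne'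
    rw [div_self hL₀.ne'] at h2
    simpa using h2.const_mul θ
  have hlimu : Tendsto (fun n : ℕ => u ^ (2 ^ n)) atTop (𝓝 θ) := hlim.congr' hev
  have hu1 : u = 1 := eq_one_of_tendsto_pow_two_pow hu hθ hlimu
  refine ⟨hu1, ?_⟩
  subst hu1
  have hone : Tendsto (fun n : ℕ => (1 : ℝ) ^ (2 ^ n)) atTop (𝓝 1) := by simp
  exact tendsto_nhds_unique hlimu hone

/-- The in-range points march to the centre GEOMETRICALLY: `x_{m+1} = (1 + x_m)² − 1 = x_m(x_m + 2)`,
and in an ultrametric field `‖x(x + t)‖ = ‖x‖·‖t‖` as soon as `‖x‖ < ‖t‖` (here `t = 2`, `‖2‖ = 1/2` in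
`ℂ₂`): so `‖x_{m+1}‖ = ‖x_m‖/2` eventually, `‖x_m‖ = C·2^{−m}`, and the ratio of two functions of
finite orders `f₀, g₀` at the centre is `θ^m·L_m` with `θ = 2^{f₀−g₀}… ` — the shape §1 consumes.  No
boundedness of LZZ's (locally analytic) distribution is used: only its power-series expansion at the
centre of the disc. -/
theorem sq_orbit_step {K : Type*} [CommRing K] (x : K) : (1 + x) ^ 2 - 1 = x * (x + 2) := by
  ring

theorem norm_mul_add_eq_of_lt {K : Type*} [NormedField K] [IsUltrametricDist K] (x t : K)
    (h : ‖x‖ < ‖t‖) : ‖x * (x + t)‖ = ‖x‖ * ‖t‖ := by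
  rw [norm_mul, IsUltrametricDist.norm_add_eq_max_of_norm_ne_norm (ne_of_lt h), max_eq_right h.le]

/-- Finite order at the centre gives the `θ^m·L_m` shape: if `a_m = r^m·A_m`, `b_m = s^m·B_m` with
`A_m → A ≠ 0`, `B_m → B ≠ 0` (`r = ‖x‖`-decay to the power `f₀`, etc.), then `b_m/a_m = (s/r)^m·(B_m/A_m)`
with `B_m/A_m → B/A ≠ 0`. -/
theorem ratio_shape {r s A B : ℝ} {Am Bm : ℕ → ℝ} (hr : 0 < r) (hA : A ≠ 0) (hB : B ≠ 0)
    (hAm : Tendsto Am atTop (𝓝 A)) (hBm : Tendsto Bm atTop (𝓝 B)) :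
    Tendsto (fun m => Bm m / Am m) atTop (𝓝 (B / A)) ∧ B / A ≠ 0 ∧
      ∀ m, Am m ≠ 0 → (s ^ m * Bm m) / (r ^ m * Am m) = (s / r) ^ m * (Bm m / Am m) := by
  refine ⟨hBm.div hAm hA, div_ne_zero hB hA, fun m hm => ?_⟩
  have hrm : r ^ m ≠ 0 := pow_ne_zero _ hr.ne'
  rw [div_pow]
  field_simp

/-- **Order transport** in exponents: `θ = 2^{g₀ − f₀} = 1` means `f₀ = g₀` — LZZ's `𝓛(A_{f₀})` and the
product `Ka·Kb` vanish to the same order at the out-of-range point; with `F(0) ≠ 0` (both Heegner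
logarithms non-zero: Bertrand, in tree, + the good-pair menu) this gives `G(0) = G0·Lin ≠ 0`, i.e. the
NON-VANISHING of Rubin's out-of-range value at `2` (what k1-g7's anchor domination needs). -/
theorem order_eq_of_theta_eq_one {f₀ g₀ : ℤ} (h : (2 : ℝ) ^ (g₀ - f₀) = 1) : f₀ = g₀ := by
  have h' : g₀ - f₀ = 0 := by
    rcases lt_trichotomy (g₀ - f₀) 0 with hlt | heq | hgt
    · exact absurd h (ne_of_lt (zpow_lt_one_of_neg₀ (by norm_num) hlt))
    · exact heq
    · exact absurd h (ne_of_gt (one_lt_zpow₀ (by norm_num) hgt))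
  omega

/-- The centre consequence, integer shadow: equal orders, `F(0) ≠ 0`, orders add under `Ka·Kb`. -/
theorem centre_nonvanishing {f₀ g₀ ga gb : ℕ} (h : f₀ = g₀) (hF : f₀ = 0) (hG : g₀ = ga + gb) :
    ga = 0 ∧ gb = 0 := by
  omega

/-! ### §2. The digit algebra of Kings–Sprang Def. 5.23 (B16 made mechanical)

`ord₂ Local(χ,Σ) = a·α₀ − b·β₀ + g`: `(a, b)` the exact powers of `(𝔭, 𝔭̄) = (v, v̄)` in `cond χ`,
`(α₀, β₀)` the infinity-type exponents, `g = ord₂ (P̃F)(c⁻¹)` (a Gauss digit of `χ_fin` only; `χ(𝔟)` is a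
unit).  Along the anticyclotomic line `χ ↦ χ·Ψ^k`, `Ψ = λ/λ̄` (conductor ONE for `K₀`: `w_{K₀} = 2` and
`(−λ)/(−λ̄) = λ/λ̄`), `χ_fin` and `(a, b)` are `k`-free and `(α₀, β₀) ↦ (α₀ + k, β₀ + k)`. -/

/-- `ord₂ Local(χ,Σ)` as a function of the conductor exponents, the type and the Gauss digit. -/
def localDigit (a b α₀ β₀ g : ℤ) : ℤ := a * α₀ - b * β₀ + g

/-- **No growing Gauss digit on a SYMMETRIC-conductor branch** (`a = b = n_v`: both Katz factors of
(W-b)′ carry `φ_d ∘ N`, conductor `2^{n_v}` at `v` AND at `v̄`): the KS digit is `k`-independent —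
k2-g6 K1's «why it might fail» does not occur in KS currency. -/
theorem localDigit_anticyclotomic (n α₀ β₀ g k : ℤ) :
    localDigit n n (α₀ + k) (β₀ + k) g = localDigit n n α₀ β₀ g := by
  unfold localDigit; ring

/-- …whereas a ONE-SIDED reading (`b = 0`, the shape of de Shalit's (37) factor `φ^kφ̄^j(𝔭ⁿ)/pⁿ`, the
critic's P-(37): `ord₂ = n_v(k − ½)`) grows linearly in `k`: the two printed normalisations put the
`k`-growth in different places, and only the NET slope is convention-free (§1 forces it to be `0`). -/
theorem localDigit_oneSided (n α₀ β₀ g k : ℤ) :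
    localDigit n 0 (α₀ + k) (β₀ + k) g = localDigit n 0 α₀ β₀ g + n * k := by
  unfold localDigit; ring

/-- Net slope bookkeeping: if the printed exponent of the factorisation constant at weight `k` is
AFFINE, `v k = w₀ + s·k`, and §1 says it is eventually constant along `k = 2^m`, then `s = 0` — read
off from two consecutive in-range points (the card's falsifier F1 computes `s` symbolically). -/
theorem slope_zero_of_two_points {w₀ s : ℤ} {m : ℕ} (v : ℤ → ℤ) (hv : ∀ k, v k = w₀ + s * k)
    (h : v (2 ^ (m + 1)) = v (2 ^ m)) : s = 0 := by
  rw [hv, hv] at h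
  have h2 : s * (2 : ℤ) ^ (m + 1) = s * 2 ^ m := by linarith
  rw [pow_succ] at h2
  have hpos : (0 : ℤ) < 2 ^ m := pow_pos (by norm_num) m
  nlinarith

/-! ### §3. The k2-g6 slots E2 / E3 filled by transport + printed digits (all `ord₂`, ℤ-valued)

Verbatim copies (same bodies) of `…HeegnerIndexTwo.K2G6.FactorisationAtTwo / FactorisationLowerAtTwo /
InRangeValuation`, so that `K2G6.vG0_lower_of_chain` consumes the conclusions below by `Iff.rfl`. -/

/-- E2 of k2-g6: `G0·Lin = W₀·𝓛(χ')`, `ord₂ W₀ = w`. -/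
def FactorisationAtTwo (vG0 vLin w vL : ℤ) : Prop :=
  vG0 + vLin = w + vL

/-- E2⁻ of k2-g6 (what LOWER needs). -/
def FactorisationLowerAtTwo (vG0 vLin w vL : ℤ) : Prop :=
  w + vL ≤ vG0 + vLin

/-- E3 of k2-g6: `ord₂ Lin = ρ + a`. -/
def InRangeValuation (vLin ρ a : ℤ) : Prop :=
  vLin = ρ + a

/-- **H_A — exponent transport on the factorisation constant** (k2-g6's convention `Ka·Kb = W₀·𝓛`,
i.e. `W₀ = G/F`).  (T) `‖W₀‖` is constant on the disc (§1: unit monomial), so its exponent at the centre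
`vW0` equals its exponent `vWk` at an in-range point `k⋆`; (C) at the centre `G0·Lin = W₀(0)·F(0)`;
(K) at `k⋆` the in-range identity `Ka(x⋆)·Kb(x⋆) = W₀(x⋆)·F(x⋆)`.  Then E2 holds with
`w := vKa⋆ + vKb⋆ − vF⋆` (three PRINTED in-range values) and `vL := vF0`. -/
theorem factorisationAtTwo_of_transport {vF0 vW0 vG0 vLin vFk vWk vKak vKbk : ℤ}
    (hT : vW0 = vWk) (hC : vG0 + vLin = vW0 + vF0) (hK : vKak + vKbk = vWk + vFk) :
    FactorisationAtTwo vG0 vLin (vKak + vKbk - vFk) vF0 := by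
  unfold FactorisationAtTwo; omega

/-- One-sided corollary (E2⁻): only the INEQUALITIES `vW0 ≤ vWk`-free direction is needed — in fact
LOWER needs `w + vF0 ≤ vG0 + vLin`, which follows from (T⁻) `vWk ≤ vW0` alone. -/
theorem factorisationLowerAtTwo_of_transport {vF0 vW0 vG0 vLin vFk vWk vKak vKbk : ℤ}
    (hT : vWk ≤ vW0) (hC : vG0 + vLin = vW0 + vF0) (hK : vKak + vKbk = vWk + vFk) :
    FactorisationLowerAtTwo vG0 vLin (vKak + vKbk - vFk) vF0 := by
  unfold FactorisationLowerAtTwo; omega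

/-- The valuation digits of ONE Kings–Sprang interpolation (Thm 5.24 / Def 5.23) at an in-range point:
`idx = ord₂ [𝒪_L^×:Γ]` (`= 1` for `K₀`, `Γ = 𝒪_𝔮^× = {1}`), `loc = ord₂ Local(χ,Σ)` (§2), `eul = ord₂` of
the Euler factors at `𝔭, 𝔭̄` (`= 0` on a `2`-ramified branch: the factors are `1`), `arc = ord₂` of
`ι((α−1)!(2πi)^{|β|}·Ω_p^αΩ_p^{∨β}/(Ω^αΩ^{∨β}))` in the chosen algebraic normalisation, `reg` = the
regularisation digit `ord₂(N𝔠 − χ(𝔠⁻¹))` if the `𝔠`-regularised measure is used (`≥ 1` at the split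
`2`: odd minus a `ℤ₂`-unit), else `0`. -/
structure KSDigits where
  idx : ℤ
  loc : ℤ
  eul : ℤ
  arc : ℤ
  reg : ℤ

/-- The total printed digit of one KS interpolation. -/
def KSDigits.total (D : KSDigits) : ℤ :=
  D.idx + D.loc + D.eul + D.arc + D.reg

/-- KS Thm 5.24 in valuations for one Katz factor: `ord₂(value) = digits + ord₂ L^{alg}`. -/
def KSInterpolation (vK vLalg : ℤ) (D : KSDigits) : Prop :=
  vK = D.total + vLalg

/-- LZZ arXiv Prop 4.12 / Cor 4.13 in valuations at weight `k`: `ord₂ F(x_k) = vC + vP + vLcent + vεL`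
with `vC = ord₂(2^{g−3}δ_E^{1/2}ζ_F(2)𝒬(f₊,f₋)/(L(1,η)²L(1,ρ_A,Ad)))`, `vP = ord₂ P_ι(χ_k)`
(`= ord₂ C_ι + k·ord₂(ζ⁺ζ⁻)`, p. 23), `vLcent = ord₂ L(1/2,ρ_A,χ_k)^{alg}`, `vεL = ord₂ ε/L²` at `𝔭`. -/
def LZZInterpolation (vF vC vP vLcent vεL : ℤ) : Prop :=
  vF = vC + vP + vLcent + vεL

/-- Artin formalism for the CM form `θ_{ψ₀}` (EXACT): `L(1/2,ρ_A × χ_k) = L(λ_k,0)·L(λ'_k,0)`; in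
algebraic normalisations the two sides differ by an explicit period/archimedean digit `vArch`. -/
def ArtinSplitting (vLcent vLa vLb vArch : ℤ) : Prop :=
  vLcent = vLa + vLb + vArch

/-- **H_B — the pin of `w` is L-VALUE-FREE.**  At any in-range point the exponent `vKa + vKb − vF` of
the factorisation constant is a combination of PRINTED constants and digits: the two algebraic
L-values cancel (the analogue of k2-g6's cancellation of `a` and `aα`).  With §1 this number is `w`. -/
theorem w_pin {vF vC vP vLcent vεL vKa vKb vLa vLb vArch : ℤ} {Da Db : KSDigits}
    (hF : LZZInterpolation vF vC vP vLcent vεL) (hA : ArtinSplitting vLcent vLa vLb vArch)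
    (ha : KSInterpolation vKa vLa Da) (hb : KSInterpolation vKb vLb Db) :
    vKa + vKb - vF = Da.total + Db.total - vC - vP - vεL - vArch := by
  unfold LZZInterpolation ArtinSplitting KSInterpolation at *
  omega

/-- **H_C — E3 from Kings–Sprang**: the in-range law of k2-g6 with `ρ := D.total` EXPLICIT
(`= 1 + loc + 0 + arc + reg` on the `2`-ramified complementary branch). -/
theorem inRangeValuation_of_KS {vLin vLalg : ℤ} {D : KSDigits} (h : KSInterpolation vLin vLalg D) :
    InRangeValuation vLin D.total vLalg :=
  h

/-- **The assembled E2 with an explicit `w`**: transport (§1) + the printed laws at ONE in-range point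
give k2-g6's `FactorisationAtTwo vG0 vLin w vL` with
`w = Da.total + Db.total − vC − vP⋆ − vεL⋆ − vArch⋆` — every summand a constant of the FIXED data
`(K₀, A_{f₀}, χ₁, f_±, 𝔠)` or a per-key local digit (B8), none an L-value, none a limit. -/
theorem factorisationAtTwo_explicit {vF0 vW0 vG0 vLin vFk vWk vKak vKbk vC vP vLcent vεL vLa vLb vArch : ℤ}
    {Da Db : KSDigits} (hT : vW0 = vWk) (hC : vG0 + vLin = vW0 + vF0)
    (hK : vKak + vKbk = vWk + vFk) (hF : LZZInterpolation vFk vC vP vLcent vεL)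
    (hA : ArtinSplitting vLcent vLa vLb vArch) (ha : KSInterpolation vKak vLa Da)
    (hb : KSInterpolation vKbk vLb Db) :
    FactorisationAtTwo vG0 vLin (Da.total + Db.total - vC - vP - vεL - vArch) vF0 := by
  have hw := w_pin hF hA ha hb
  have hE := factorisationAtTwo_of_transport hT hC hK
  unfold FactorisationAtTwo at *
  omega

/-- **Both embeddings in one theorem** (k3-g6's conjugate run, R53): KS treats `(𝒜, Σ)` and `(𝒜^∨, Σ̄)`
symmetrically; the `ι∘c̃` run swaps `(a,b)`, `(α₀,β₀)` in Def 5.23, so its local digit is the same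
formula with the arguments exchanged — for a symmetric conductor the two runs have local digits
differing by the type asymmetry only. -/
theorem localDigit_conjugate (n α₀ β₀ g : ℤ) :
    localDigit n n β₀ α₀ g = localDigit n n α₀ β₀ g + 2 * n * (β₀ - α₀) := by
  unfold localDigit; ring

end Summit.BirchSwinnertonDyer.BirchSwinnertonDyer.Cruxes.SplitBadTwoLowerHalfOfFacts.HeegnerIndexTwo.K2G7

end
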